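import Summits.CriticalPhenomena.SAWScalingLimit.Theses.SAWAsymptoticMorera
import Summits.CriticalPhenomena.SAWScalingLimit.Theorems.SAWTwistedSelfEnergySubseqIdentificationParaReduction
import HarnessLib

/-!
# Split glue for `SAWAsymptoticMorera.SubseqIdentification` (stmt-CriticalPhenomena-0783; crux-strategist s2)

`S2 → (S2 → ParaMartingaleLimitCap) → LimitsDescribable → EndpointRobust → SAWAsymptoticMorera.SubseqIdentification`,
all four antecedents written out (they are the children `SlitParaObservableUniform`, `ParaMartingalesOfSlitUniform`,
`LimitsDescribable` (= stmt-4481), `EndpointRobust` (= stmt-0776) of the route split), from LANDED inputs only: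
S5 `stub_existsRootedApprox` (p166209), S4 `stub_paraObservableCharacterisesSLECap` (p168572),
`tendsto_integral_of_endpointRobust` (ParaReduction), `MarkedDomain.exists_isChordalUniformizing_holds`.

* S2 = slit-uniform, normalisation-free convergence of the Doob-normalised spin-5/8 vertex observable `paraDoob` to
  the hull functional `hullParaObs` at capped pasts off the no-return event (line `parafermionic-martingale`, verbatim);
* ParaMartingaleLimitCap = every describable probability subsequential limit of the SAW laws of a lattice-rooted
  approximation carries the capped parafermionic martingales `paraObsCap` (the output of the line's passage S3a+S3c).

No `sorry`; axioms standard. The Morera decl is concluded BY NAME (it is definitionally the shared crux).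
-/

noncomputable section

open MeasureTheory Filter Topology Set
open scoped NNReal ENNReal Classical BigOperators
open Literature.Probability.LatticeModels
open Literature.Probability.RandomPlanarGeometry
open UpperHalfPlane (upperHalfPlaneSet)

namespace Summit.CriticalPhenomena.SAWScalingLimit.Theorems.SubseqIdentification.ParaMartingale

open Summit.CriticalPhenomena.SAWScalingLimit.Theses.SAWLaplacianWalk (LimitsDescribable)
open Summit.CriticalPhenomena.SAWScalingLimit.Theses.SAWConfRestriction (EndpointRobust)
open Summit.CriticalPhenomena.SAWScalingLimit.Theorems.SubseqIdentification.RoomEntropy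
  (prefixAt noReturnEvent)

/-- **Split glue (strategist s2)**: S2 → (S2 → capped para martingales of describable subsequential limits) →
`LimitsDescribable` → `EndpointRobust` → `SAWAsymptoticMorera.SubseqIdentification`. Proof: modus ponens, then the
tail of `SubseqIdentification_of_paraObservable` — rooted approximation (S5), transfer of the weak limit
(`EndpointRobust`), describability (`LimitsDescribable`), capped martingales, capped endgame (S4). [folklore] -/
theorem SubseqIdentification_morera_of_slitUniform_of_passage :
    (∀ (D : DobrushinDomain) (a a' b : ℝ → Site 2) (φ : ConformalEquiv upperHalfPlaneSet D.carrier),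
        IsLatticeRooted D a a' b → D.IsChordalUniformizing φ →
        ∀ w : ℂ, 0 < w.im → ∀ (zδ : ℝ → Site 2),
          Tendsto (fun δ => meshPoint δ (zδ δ)) (𝓝[>] (0 : ℝ)) (𝓝 (φ w)) →
          (∃ C : ℝ, ∀ᶠ δ in 𝓝[>] (0 : ℝ), ∀ (γ : SAW.DomainSAW D.carrier δ (a δ) (b δ)) (k : ℕ),
              LatticeSlit.capTime φ (prefixAt γ k) ≤ w.im ^ 2 / 16 →
              ‖paraDoob D δ (a δ) (a' δ) (b δ) (zδ δ) γ k‖ ≤ C) ∧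
          ∀ ε : ℝ, 0 < ε → ∃ R : ℝ, 0 < R ∧ ∀ r : ℝ, 0 < r → r < R → ∀ᶠ δ in 𝓝[>] (0 : ℝ),
            ∀ (γ : SAW.DomainSAW D.carrier δ (a δ) (b δ)), γ ∉ noReturnEvent D δ (a δ) (b δ) R r →
              ∀ k : ℕ, LatticeSlit.capTime φ (prefixAt γ k) ≤ w.im ^ 2 / 16 →
                ‖paraDoob D δ (a δ) (a' δ) (b δ) (zδ δ) γ k -
                    hullParaObs (LatticeSlit.pastHull φ (prefixAt γ k)) (LatticeSlit.drivingValue φ (prefixAt γ k)) w‖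
                  ≤ ε) →
    ((∀ (D : DobrushinDomain) (a a' b : ℝ → Site 2) (φ : ConformalEquiv upperHalfPlaneSet D.carrier),
        IsLatticeRooted D a a' b → D.IsChordalUniformizing φ →
        ∀ w : ℂ, 0 < w.im → ∀ (zδ : ℝ → Site 2),
          Tendsto (fun δ => meshPoint δ (zδ δ)) (𝓝[>] (0 : ℝ)) (𝓝 (φ w)) →
          (∃ C : ℝ, ∀ᶠ δ in 𝓝[>] (0 : ℝ), ∀ (γ : SAW.DomainSAW D.carrier δ (a δ) (b δ)) (k : ℕ),
              LatticeSlit.capTime φ (prefixAt γ k) ≤ w.im ^ 2 / 16 →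
              ‖paraDoob D δ (a δ) (a' δ) (b δ) (zδ δ) γ k‖ ≤ C) ∧
          ∀ ε : ℝ, 0 < ε → ∃ R : ℝ, 0 < R ∧ ∀ r : ℝ, 0 < r → r < R → ∀ᶠ δ in 𝓝[>] (0 : ℝ),
            ∀ (γ : SAW.DomainSAW D.carrier δ (a δ) (b δ)), γ ∉ noReturnEvent D δ (a δ) (b δ) R r →
              ∀ k : ℕ, LatticeSlit.capTime φ (prefixAt γ k) ≤ w.im ^ 2 / 16 →
                ‖paraDoob D δ (a δ) (a' δ) (b δ) (zδ δ) γ k -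
                    hullParaObs (LatticeSlit.pastHull φ (prefixAt γ k)) (LatticeSlit.drivingValue φ (prefixAt γ k)) w‖
                  ≤ ε) →
      (∀ (D : DobrushinDomain) (a a' b : ℝ → Site 2)
          (φ : ConformalEquiv upperHalfPlaneSet D.carrier) (μ : Measure (CurveClass ℂ)),
          IsLatticeRooted D a a' b → D.IsChordalUniformizing φ → IsProbabilityMeasure μ →
          IsSubseqLimitLaw (fun δ (γ : SAW.DomainSAW D.carrier δ (a δ) (b δ)) => γ.curve)
            (fun δ => SAW.law D.carrier δ (a δ) (b δ)) μ →
          (∀ᵐ c ∂μ, IsLoewnerDescribable φ c ∧ c.source = D.pt 0) →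
          ∃ 𝓕 : Filtration ℝ≥0 (inferInstance : MeasurableSpace (CurveClass ℂ)),
            Adapted 𝓕 (fun t c => drivingFunction φ c t) ∧
            ∀ w : ℂ, 0 < w.im →
              Martingale (fun t c => paraObsCap (drivingFunction φ c) w t) 𝓕 μ)) →
    LimitsDescribable → EndpointRobust →
    Summit.CriticalPhenomena.SAWScalingLimit.Theses.SAWAsymptoticMorera.SubseqIdentification := by
  intro hO hP hR hE D a b hab s μ hs hμ hlim
  have hM := hP hO
  obtain ⟨a₁, a₁', b₁, hroot⟩ := stub_existsRootedApprox D a b hab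
  have hlim₁ : ∀ f : BoundedContinuousFunction (CurveClass ℂ) ℝ,
      Tendsto (fun n => ∫ γ, f γ.curve ∂(SAW.law D.carrier (s n) (a₁ (s n)) (b₁ (s n)))) atTop
        (𝓝 (∫ x, f x ∂μ)) := fun f =>
    tendsto_integral_of_endpointRobust hE hab hroot.1 hs f (hlim f)
  have hsub : IsSubseqLimitLaw (fun δ (γ : SAW.DomainSAW D.carrier δ (a₁ δ) (b₁ δ)) => γ.curve)
      (fun δ => SAW.law D.carrier δ (a₁ δ) (b₁ δ)) μ := ⟨s, hs, hlim₁⟩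
  obtain ⟨φ, hφ⟩ := MarkedDomain.exists_isChordalUniformizing_holds D
  have hdesc := hR D a₁ b₁ hroot.1 φ hφ μ hμ hsub
  haveI := hμ
  obtain ⟨𝓕, hW, hN⟩ := hM D a₁ a₁' b₁ φ μ hroot hφ hμ hsub hdesc
  exact stub_paraObservableCharacterisesSLECap D φ μ hφ hμ hdesc 𝓕 hW hN

/-- The same glue for the primary decl `SAWTwistedSelfEnergy.SubseqIdentification` (identical text; `Iff.rfl`). -/
theorem SubseqIdentification_of_slitUniform_of_passage :
    (∀ (D : DobrushinDomain) (a a' b : ℝ → Site 2) (φ : ConformalEquiv upperHalfPlaneSet D.carrier),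
        IsLatticeRooted D a a' b → D.IsChordalUniformizing φ →
        ∀ w : ℂ, 0 < w.im → ∀ (zδ : ℝ → Site 2),
          Tendsto (fun δ => meshPoint δ (zδ δ)) (𝓝[>] (0 : ℝ)) (𝓝 (φ w)) →
          (∃ C : ℝ, ∀ᶠ δ in 𝓝[>] (0 : ℝ), ∀ (γ : SAW.DomainSAW D.carrier δ (a δ) (b δ)) (k : ℕ),
              LatticeSlit.capTime φ (prefixAt γ k) ≤ w.im ^ 2 / 16 →
              ‖paraDoob D δ (a δ) (a' δ) (b δ) (zδ δ) γ k‖ ≤ C) ∧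
          ∀ ε : ℝ, 0 < ε → ∃ R : ℝ, 0 < R ∧ ∀ r : ℝ, 0 < r → r < R → ∀ᶠ δ in 𝓝[>] (0 : ℝ),
            ∀ (γ : SAW.DomainSAW D.carrier δ (a δ) (b δ)), γ ∉ noReturnEvent D δ (a δ) (b δ) R r →
              ∀ k : ℕ, LatticeSlit.capTime φ (prefixAt γ k) ≤ w.im ^ 2 / 16 →
                ‖paraDoob D δ (a δ) (a' δ) (b δ) (zδ δ) γ k -
                    hullParaObs (LatticeSlit.pastHull φ (prefixAt γ k)) (LatticeSlit.drivingValue φ (prefixAt γ k)) w‖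
                  ≤ ε) →
    ((∀ (D : DobrushinDomain) (a a' b : ℝ → Site 2) (φ : ConformalEquiv upperHalfPlaneSet D.carrier),
        IsLatticeRooted D a a' b → D.IsChordalUniformizing φ →
        ∀ w : ℂ, 0 < w.im → ∀ (zδ : ℝ → Site 2),
          Tendsto (fun δ => meshPoint δ (zδ δ)) (𝓝[>] (0 : ℝ)) (𝓝 (φ w)) →
          (∃ C : ℝ, ∀ᶠ δ in 𝓝[>] (0 : ℝ), ∀ (γ : SAW.DomainSAW D.carrier δ (a δ) (b δ)) (k : ℕ),
              LatticeSlit.capTime φ (prefixAt γ k) ≤ w.im ^ 2 / 16 →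
              ‖paraDoob D δ (a δ) (a' δ) (b δ) (zδ δ) γ k‖ ≤ C) ∧
          ∀ ε : ℝ, 0 < ε → ∃ R : ℝ, 0 < R ∧ ∀ r : ℝ, 0 < r → r < R → ∀ᶠ δ in 𝓝[>] (0 : ℝ),
            ∀ (γ : SAW.DomainSAW D.carrier δ (a δ) (b δ)), γ ∉ noReturnEvent D δ (a δ) (b δ) R r →
              ∀ k : ℕ, LatticeSlit.capTime φ (prefixAt γ k) ≤ w.im ^ 2 / 16 →
                ‖paraDoob D δ (a δ) (a' δ) (b δ) (zδ δ) γ k -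
                    hullParaObs (LatticeSlit.pastHull φ (prefixAt γ k)) (LatticeSlit.drivingValue φ (prefixAt γ k)) w‖
                  ≤ ε) →
      (∀ (D : DobrushinDomain) (a a' b : ℝ → Site 2)
          (φ : ConformalEquiv upperHalfPlaneSet D.carrier) (μ : Measure (CurveClass ℂ)),
          IsLatticeRooted D a a' b → D.IsChordalUniformizing φ → IsProbabilityMeasure μ →
          IsSubseqLimitLaw (fun δ (γ : SAW.DomainSAW D.carrier δ (a δ) (b δ)) => γ.curve)
            (fun δ => SAW.law D.carrier δ (a δ) (b δ)) μ →
          (∀ᵐ c ∂μ, IsLoewnerDescribable φ c ∧ c.source = D.pt 0) →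
          ∃ 𝓕 : Filtration ℝ≥0 (inferInstance : MeasurableSpace (CurveClass ℂ)),
            Adapted 𝓕 (fun t c => drivingFunction φ c t) ∧
            ∀ w : ℂ, 0 < w.im →
              Martingale (fun t c => paraObsCap (drivingFunction φ c) w t) 𝓕 μ)) →
    LimitsDescribable → EndpointRobust →
    Summit.CriticalPhenomena.SAWScalingLimit.Theses.SAWTwistedSelfEnergy.SubseqIdentification :=
  SubseqIdentification_morera_of_slitUniform_of_passage

end Summit.CriticalPhenomena.SAWScalingLimit.Theorems.SubseqIdentification.ParaMartingale

end
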